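import Summits.ValiantsHypothesis.ValiantsHypothesis.Theorems.KPlusLogSqLawTropicalSymmetricThreeFourFifteenCarriers

/-!
# Route «KPlusLogSqLaw» — the SYMMETRIC `(3,4)` tropical row — the MIRROR of Family A (rank reversal + chain reversal)

HONEST FRAMING.  Helper file (seat val-sym-lift-p2 (g6), cell `pub-symmetroid`, 2026-08-27; `--supports` the `WeakLifting` item
stmt-ValiantsHypothesis-19561 as a helper, no closure claim).  A SMALL-FORMAT statement in the single-term-carrier model, far inside the
known regime of the cruxes; nothing here is about `TropicalB` / `WeakLifting` in their windows, Conjecture B, the real census numeral of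
Door A at `(3,4)` (`PosRootLawAt 3 4 18`, OPEN, never asserted), `MatrixDescartes` (stmt-ValiantsHypothesis-18050) or VP ≠ VNP.

THIS FILE.  The abstract hypotheses of the pairwise relaxation (cycle-constancy, same-row monotonicity, distinct multisets, increasing
slopes, the two crossing cancellations, monotone rank exponents `g`, the sign rules `hD`/`hT` and alternation) are SELF-DUAL under the
mirror `rank x ↦ 3 − x`, chain order reversed, `g x ↦ (Σ g) − g (3 − x)`: `familyB` transports `familyA` and `lemmaV2` through this duality.
Consequently a chain cannot carry `{0,1,3}, {1,1,2}, {1,2,2}, {1,1,3}` while missing `{0,2,3}` and (carrying `{0,3,3}`, or missing `{0,3,3}`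
and carrying `{1,2,3}`) — the mirror images of `lemmaV2` resp. `familyA`. [cell statement R1668 «Lemma Z»; bookkeeping]
-/

set_option linter.dupNamespace false
set_option autoImplicit false

namespace Summit.ValiantsHypothesis.ValiantsHypothesis.Theorems.KPlusLogSqLaw

open Summit.ValiantsHypothesis.ValiantsHypothesis.Theorems.MatrixDescartes.Negative
open Summit.ValiantsHypothesis.ValiantsHypothesis.Theorems.LacunarySymmetroidMatrixDescartes
open Summit.ValiantsHypothesis.ValiantsHypothesis.Theorems.LacunarySymmetroidMatrixDescartes.TropicalCensus
open Finset

namespace SymmetricThreeFourFifteen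

open SymmetricThreeFour SymmetricThreeFourSeventeen SymmetricThreeFourSixteen

/-! ## Mirror bookkeeping -/

/-- the class multiset of the rank-reversed term is the reversed class multiset. -/
theorem classSym_mirror (σ : Equiv.Perm (Fin 3)) (c : Fin 3 → Fin 4) :
    TropicalCensus.classSym ((σ, fun i => (c i).rev) : Equiv.Perm (Fin 3) × (Fin 3 → Fin 4)) =
      Sym.map Fin.rev (TropicalCensus.classSym ((σ, c) : Equiv.Perm (Fin 3) × (Fin 3 → Fin 4))) := by
  unfold TropicalCensus.classSym
  apply Subtype.ext
  simp [Sym.map]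

/-- a carried multiset of the chain is carried, reversed, by the mirrored chain (index `a.rev`). -/
theorem hit_mirror {n : ℕ} (r : Fin (n + 1) → Equiv.Perm (Fin 3) × (Fin 3 → Fin 4)) (w w' : Fin 3 → Fin 4)
    (hw : TropicalCensus.classSym (((1 : Equiv.Perm (Fin 3)), fun i => (w' i).rev) : Equiv.Perm (Fin 3) × (Fin 3 → Fin 4)) =
      TropicalCensus.classSym ((1 : Equiv.Perm (Fin 3)), w))
    {a : Fin (n + 1)} (ha : TropicalCensus.classSym (r a) = TropicalCensus.classSym ((1 : Equiv.Perm (Fin 3)), w')) :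
    TropicalCensus.classSym (((r a.rev.rev).1, fun i => ((r a.rev.rev).2 i).rev) : Equiv.Perm (Fin 3) × (Fin 3 → Fin 4)) =
      TropicalCensus.classSym ((1 : Equiv.Perm (Fin 3)), w) := by
  rw [Fin.rev_rev, classSym_mirror, Prod.mk.eta, ha, ← hw, classSym_mirror]

/-- a multiset missed by the chain is missed, reversed, by the mirrored chain. -/
theorem miss_mirror {n : ℕ} (r : Fin (n + 1) → Equiv.Perm (Fin 3) × (Fin 3 → Fin 4)) (w w' : Fin 3 → Fin 4)
    (hw : TropicalCensus.classSym (((1 : Equiv.Perm (Fin 3)), fun i => (w' i).rev) : Equiv.Perm (Fin 3) × (Fin 3 → Fin 4)) =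
      TropicalCensus.classSym ((1 : Equiv.Perm (Fin 3)), w))
    (hmiss : ∀ a, TropicalCensus.classSym (r a) ≠ TropicalCensus.classSym ((1 : Equiv.Perm (Fin 3)), w')) (a : Fin (n + 1)) :
    TropicalCensus.classSym (((r a.rev).1, fun i => ((r a.rev).2 i).rev) : Equiv.Perm (Fin 3) × (Fin 3 → Fin 4)) ≠
      TropicalCensus.classSym ((1 : Equiv.Perm (Fin 3)), w) := by
  intro h
  rw [classSym_mirror, Prod.mk.eta, ← hw, classSym_mirror] at h
  exact hmiss a.rev (Sym.map_injective Fin.rev_injective _ h)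

/-- every rank exponent is below the total. -/
theorem g_le_total (g : Fin 4 → ℕ) (y : Fin 4) : g y ≤ g 0 + g 1 + g 2 + g 3 := by
  rcases f4_cases y with rfl | rfl | rfl | rfl <;> omega

/-- the slope of a mirrored term under the mirrored exponents. -/
theorem slope_mirror (g : Fin 4 → ℕ) (q : Equiv.Perm (Fin 3) × (Fin 3 → Fin 4)) :
    TropicalCensus.slope (fun x => g 0 + g 1 + g 2 + g 3 - g x.rev) ((q.1, fun i => (q.2 i).rev) : Equiv.Perm (Fin 3) × (Fin 3 → Fin 4)) =
      3 * ((g 0 + g 1 + g 2 + g 3 : ℕ) : ℤ) - TropicalCensus.slope g q := by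
  unfold TropicalCensus.slope
  rw [Fin.sum_univ_three, Fin.sum_univ_three]
  simp only [Fin.rev_rev]
  have h0 := g_le_total g (q.2 0)
  have h1 := g_le_total g (q.2 1)
  have h2 := g_le_total g (q.2 2)
  push_cast [Nat.cast_sub h0, Nat.cast_sub h1, Nat.cast_sub h2]
  ring

/-! ## Family B = mirror of Family A -/

/-- **Family B is impossible with signs** (mirror of `familyA` / `lemmaV2`).  A chain with the pairwise exchange hypotheses and the sign
rules cannot carry `{0,1,3}, {1,1,2}, {1,2,2}, {1,1,3}`, miss `{0,2,3}`, and (carry `{0,3,3}`, or miss `{0,3,3}` and carry `{1,2,3}`).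
Proof: apply `lemmaV2` resp. `familyA` to the mirrored chain `a ↦ (σ_{rev a}, rev ∘ c_{rev a})` with exponents `x ↦ Σg − g(rev x)`, signs
`a ↦ s (rev a)` and letters `A k (rev x)`; all hypotheses transport (the two cancellations swap). [bookkeeping] -/
theorem familyB {n : ℕ} (r : Fin (n + 1) → Equiv.Perm (Fin 3) × (Fin 3 → Fin 4)) (g : Fin 4 → ℕ) (hmono : Monotone g)
    (s : Fin (n + 1) → ℤ) (A : Fin 3 → Fin 4 → ℤ)
    (h1 : ∀ k i, (r k).2 ((r k).1 i) = (r k).2 i)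
    (h2 : ∀ a b : Fin (n + 1), a < b → ∀ i, (r a).1 i = (r b).1 i → (r a).2 i ≤ (r b).2 i)
    (h3 : Function.Injective fun k => TropicalCensus.classSym (r k))
    (hS : ∀ a b : Fin (n + 1), a < b → TropicalCensus.slope g (r a) < TropicalCensus.slope g (r b))
    (h6 : ∀ a b : Fin (n + 1), a < b → (r a).1 = 1 → ∀ i j : Fin 3, i ≠ j → (r b).1 i = j → (r b).1 j = i →
      g ((r a).2 i) + g ((r a).2 j) < 2 * g ((r b).2 i))
    (h7 : ∀ a b : Fin (n + 1), a < b → (r b).1 = 1 → ∀ i j : Fin 3, i ≠ j → (r a).1 i = j → (r a).1 j = i →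
      2 * g ((r a).2 i) < g ((r b).2 i) + g ((r b).2 j))
    (hD : ∀ a, (r a).1 = 1 → s a = ∏ k, A k ((r a).2 k))
    (hT : ∀ (a : Fin (n + 1)) (k : Fin 3), (r a).1 ≠ 1 → (r a).1 k = k → ∀ t : ℤ, s a * t < 0 ↔ -A k ((r a).2 k) * t < 0)
    (halt : ∀ k : Fin n, s k.castSucc * s k.succ < 0)
    (hit013 : ∃ a, TropicalCensus.classSym (r a) = TropicalCensus.classSym ((1 : Equiv.Perm (Fin 3)), (![0, 1, 3] : Fin 3 → Fin 4)))
    (hit112 : ∃ a, TropicalCensus.classSym (r a) = TropicalCensus.classSym ((1 : Equiv.Perm (Fin 3)), (![1, 1, 2] : Fin 3 → Fin 4)))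
    (hit122 : ∃ a, TropicalCensus.classSym (r a) = TropicalCensus.classSym ((1 : Equiv.Perm (Fin 3)), (![1, 2, 2] : Fin 3 → Fin 4)))
    (hit113 : ∃ a, TropicalCensus.classSym (r a) = TropicalCensus.classSym ((1 : Equiv.Perm (Fin 3)), (![1, 1, 3] : Fin 3 → Fin 4)))
    (miss023 : ∀ a, TropicalCensus.classSym (r a) ≠ TropicalCensus.classSym ((1 : Equiv.Perm (Fin 3)), (![0, 2, 3] : Fin 3 → Fin 4)))
    (hXY : (∃ a, TropicalCensus.classSym (r a) = TropicalCensus.classSym ((1 : Equiv.Perm (Fin 3)), (![0, 3, 3] : Fin 3 → Fin 4))) ∨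
      ((∀ a, TropicalCensus.classSym (r a) ≠ TropicalCensus.classSym ((1 : Equiv.Perm (Fin 3)), (![0, 3, 3] : Fin 3 → Fin 4))) ∧
        ∃ a, TropicalCensus.classSym (r a) = TropicalCensus.classSym ((1 : Equiv.Perm (Fin 3)), (![1, 2, 3] : Fin 3 → Fin 4)))) :
    False := by
  -- the mirrored data: `R a = (σ_{rev a}, rev ∘ c_{rev a})`, `g' x = Σg − g (rev x)`, `s' a = s (rev a)`, `A' k x = A k (rev x)`
  have h1' : ∀ (k : Fin (n + 1)) (i : Fin 3), ((r k.rev).2 ((r k.rev).1 i)).rev = ((r k.rev).2 i).rev := fun k i => by rw [h1]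
  have h2' : ∀ a b : Fin (n + 1), a < b → ∀ i, (r a.rev).1 i = (r b.rev).1 i → ((r a.rev).2 i).rev ≤ ((r b.rev).2 i).rev :=
    fun a b hab i hσ => Fin.rev_le_rev.mpr (h2 b.rev a.rev (Fin.rev_lt_rev.mpr hab) i hσ.symm)
  have h3' : Function.Injective fun k : Fin (n + 1) =>
      TropicalCensus.classSym (((r k.rev).1, fun i => ((r k.rev).2 i).rev) : Equiv.Perm (Fin 3) × (Fin 3 → Fin 4)) := by
    intro a b hab
    dsimp only at hab
    rw [classSym_mirror, classSym_mirror, Prod.mk.eta, Prod.mk.eta] at hab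
    exact Fin.rev_injective (h3 (Sym.map_injective Fin.rev_injective _ hab))
  have hS' : ∀ a b : Fin (n + 1), a < b →
      TropicalCensus.slope (fun x => g 0 + g 1 + g 2 + g 3 - g x.rev)
          (((r a.rev).1, fun i => ((r a.rev).2 i).rev) : Equiv.Perm (Fin 3) × (Fin 3 → Fin 4)) <
        TropicalCensus.slope (fun x => g 0 + g 1 + g 2 + g 3 - g x.rev)
          (((r b.rev).1, fun i => ((r b.rev).2 i).rev) : Equiv.Perm (Fin 3) × (Fin 3 → Fin 4)) := by
    intro a b hab
    rw [slope_mirror, slope_mirror]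
    have := hS b.rev a.rev (Fin.rev_lt_rev.mpr hab)
    linarith
  have h6' : ∀ a b : Fin (n + 1), a < b → (r a.rev).1 = 1 → ∀ i j : Fin 3, i ≠ j → (r b.rev).1 i = j → (r b.rev).1 j = i →
      (g 0 + g 1 + g 2 + g 3 - g ((r a.rev).2 i).rev.rev) + (g 0 + g 1 + g 2 + g 3 - g ((r a.rev).2 j).rev.rev) <
        2 * (g 0 + g 1 + g 2 + g 3 - g ((r b.rev).2 i).rev.rev) := by
    intro a b hab ha1 i j hij hbi hbj
    simp only [Fin.rev_rev]
    have hC := h7 b.rev a.rev (Fin.rev_lt_rev.mpr hab) ha1 i j hij hbi hbj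
    have := g_le_total g ((r a.rev).2 i)
    have := g_le_total g ((r a.rev).2 j)
    have := g_le_total g ((r b.rev).2 i)
    omega
  have h7' : ∀ a b : Fin (n + 1), a < b → (r b.rev).1 = 1 → ∀ i j : Fin 3, i ≠ j → (r a.rev).1 i = j → (r a.rev).1 j = i →
      2 * (g 0 + g 1 + g 2 + g 3 - g ((r a.rev).2 i).rev.rev) <
        (g 0 + g 1 + g 2 + g 3 - g ((r b.rev).2 i).rev.rev) + (g 0 + g 1 + g 2 + g 3 - g ((r b.rev).2 j).rev.rev) := by
    intro a b hab hb1 i j hij hai haj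
    simp only [Fin.rev_rev]
    have hC := h6 b.rev a.rev (Fin.rev_lt_rev.mpr hab) hb1 i j hij hai haj
    have := g_le_total g ((r a.rev).2 i)
    have := g_le_total g ((r b.rev).2 i)
    have := g_le_total g ((r b.rev).2 j)
    omega
  have hmono' : Monotone (fun x : Fin 4 => g 0 + g 1 + g 2 + g 3 - g x.rev) := by
    intro x y hxy
    exact Nat.sub_le_sub_left (hmono (Fin.rev_le_rev.mpr hxy)) _
  have h8' : ∀ (a b : Fin (n + 1)) (i j : Fin 3), ((r a.rev).2 i).rev ≤ ((r b.rev).2 j).rev →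
      (g 0 + g 1 + g 2 + g 3 - g ((r a.rev).2 i).rev.rev) ≤ (g 0 + g 1 + g 2 + g 3 - g ((r b.rev).2 j).rev.rev) :=
    fun a b i j h => hmono' h
  have hD' : ∀ a : Fin (n + 1), (r a.rev).1 = 1 → s a.rev = ∏ k, A k ((r a.rev).2 k).rev.rev := by
    intro a ha; simp only [Fin.rev_rev]; exact hD a.rev ha
  have hT' : ∀ (a : Fin (n + 1)) (k : Fin 3), (r a.rev).1 ≠ 1 → (r a.rev).1 k = k → ∀ t : ℤ,
      s a.rev * t < 0 ↔ -A k ((r a.rev).2 k).rev.rev * t < 0 := by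
    intro a k hne hk t; simp only [Fin.rev_rev]; exact hT a.rev k hne hk t
  have halt' : ∀ k : Fin n, s k.castSucc.rev * s k.succ.rev < 0 := by
    intro k; rw [Fin.rev_castSucc, Fin.rev_succ, mul_comm]; exact halt k.rev
  -- carried / missed multisets of the mirrored chain
  obtain ⟨b, hb⟩ := hit013
  obtain ⟨c, hc⟩ := hit112
  obtain ⟨e, he⟩ := hit122
  obtain ⟨f, hf⟩ := hit113
  have hb' := hit_mirror r ![0, 2, 3] ![0, 1, 3] (by decide) hb
  have he' := hit_mirror r ![1, 2, 2] ![1, 1, 2] (by decide) hc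
  have hc' := hit_mirror r ![1, 1, 2] ![1, 2, 2] (by decide) he
  have hf' := hit_mirror r ![0, 2, 2] ![1, 1, 3] (by decide) hf
  have hno013 := miss_mirror r ![0, 1, 3] ![0, 2, 3] (by decide) miss023
  rcases hXY with ⟨z, hz⟩ | ⟨miss033, a₀, ha⟩
  · -- `{0,3,3}` carried: the mirror carries `{0,0,3}, {0,2,3}, {1,1,2}, {1,2,2}` — `lemmaV2`
    have hz' := hit_mirror r ![0, 0, 3] ![0, 3, 3] (by decide) hz
    have hg' := lemmaY2 (fun k => (((r k.rev).1, fun i => ((r k.rev).2 i).rev) : Equiv.Perm (Fin 3) × (Fin 3 → Fin 4)))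
      (fun x => g 0 + g 1 + g 2 + g 3 - g x.rev) h1' h2' h6' h7' h8' b.rev c.rev hb' he'
    exact lemmaV2 (fun k => (((r k.rev).1, fun i => ((r k.rev).2 i).rev) : Equiv.Perm (Fin 3) × (Fin 3 → Fin 4)))
      (fun x => g 0 + g 1 + g 2 + g 3 - g x.rev) h1' h2' h6' h7' h8' hg' z.rev b.rev e.rev c.rev hz' hb' hc' he'
  · -- `{0,3,3}` missed, `{1,2,3}` carried: the mirror is in Family A
    have ha' := hit_mirror r ![0, 1, 2] ![1, 2, 3] (by decide) ha
    have hno003 := miss_mirror r ![0, 0, 3] ![0, 3, 3] (by decide) miss033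
    exact familyA (fun k => (((r k.rev).1, fun i => ((r k.rev).2 i).rev) : Equiv.Perm (Fin 3) × (Fin 3 → Fin 4)))
      (fun x => g 0 + g 1 + g 2 + g 3 - g x.rev) hmono' (fun a => s a.rev) (fun k x => A k x.rev) h1' h2' h3' hS' h6' h7' hD' hT'
      halt' a₀.rev b.rev e.rev f.rev c.rev ha' hb' hc' hf' he' hno003 hno013

end SymmetricThreeFourFifteen

end Summit.ValiantsHypothesis.ValiantsHypothesis.Theorems.KPlusLogSqLaw
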